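import Summits.ABC.IUTFork.Charitable.Thm311D2Countermodel
import Summits.ABC.IUTFork.Charitable.Thm311D2PrintSense
import HarnessLib

/-!
# [IUTchIII] Thm 3.11, team D2 — the (b)-line for the PRINT-SENSE typing `Thm311PrintSense_2` (branch D, team D2 adversary; rung LADDER-ABC:A2.D)

Proof-and-witness file of the abc-iut cell (seat abc-iut-D2-cx; requested by the team anchor abc-iut-D2-typ 2026-08-26T07:08:30Z).
TAKES NO SIDE on [IUTchIII] Cor. 3.12 or on any author; locates / conditionally verifies; typed ≠ proved; establishment = our kernel check.

INPUT: `Thm311PrintSense_2 S := PartI S ∧ PartII S ∧ (III_ab ∧ III_c_Stabilized ∧ III_c_InvisibleRootsOfUnity ∧ III_d)`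
(`Charitable/Thm311D2PrintSense.lean`, p430271) — team D2's typing of Thm 3.11 (i)–(iii) with (iii)(c)/(d)'s final sentences in the
sense Rmk. 3.11.4 (i) fixes (kurims `paper:url-4b091feeb646` p. 171 l. 13–23, p. 172 l. 34–41): invisibility of the root-of-unity
indeterminacies on the (ii)(b),(c) data; and its STRONG named variant `III_c_IndNoEffect` (Rmk. 3.11.4 (iii), p. 173 l. 15–24).

FINDINGS (kernel; any prime `p`, packaged at `p = 2`):
 * §1 BOTH invisibility clauses HOLD at the pinned countermodel of record, every column: every (Ind1)/(Ind2) generator acts by signs,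
   fixes the Θ-monoid's Kummer image `Ψ` (`image_Psi_of_actsBySigns`) and the number-field copies `Mmod = ⊤`; hence
   `printSense_2_holds : Thm311PrintSense_2 (L p)` and `indNoEffect_holds : III_c_IndNoEffect (L p)`.
 * §2 (b) for the print-sense typing: `countermodel_printSense` — the typed Thm 3.11 of record ∧ bridge hypotheses ∧ `|log(q)| > 0` ∧
   three pins ∧ `Thm311PrintSense_2` ∧ `III_c_IndNoEffect` ∧ `¬ S` ∧ `¬ Statement` (honest volumes `−|log(Θ)| = (5/2)·(−|log(q)|)`);
   schema forms `not_derivation_printSense` (⇏ S) and `not_derivation_printSense_statement` (⇏ the inequality), the strong variant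
   granted as an extra antecedent.
 * §3 INDEPENDENCE: the same print-sense typing (it has no `qK`/setting binder) ALSO sits, with the three pins, the bridge hypotheses and
   `|log(q)| > 0`, on the identified-copies setting `idSetting` where `S` and the inequality HOLD (`printSense_with_S`): `S` is
   independent of `Thm311PrintSense_2 ∧ pins ∧ BridgeHyps ∧ |log(q)|>0` (`printSense_independent_of_S`).
Interface level over `l⋇ = 2`, one bad place; NOT a model of initial Θ-data; no judgement on print. [claim: Mochizuki2012, status: disputed]
-/

noncomputable section

open Set

namespace Summit.ABC.IUTFork.Charitable.D2

open Thm311 Cor312 Cor312Vol Cor312Vol.PinnedWitness Cor312Vol.NaiveWitness Cor312Vol.PinnedHonest Cor312.Checks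
  Cor312.IdentifiedNonVacuity Literature.IUT.LogThetaLattice

section model
variable (p : ℕ)

/-! ## 1. The invisibility clauses HOLD at the model of record -/

/-- Rmk. 3.11.4 (iii) read STRONGLY holds in the naive model: every (Ind1)/(Ind2) generator acts by signs, so it fixes `Ψ` and
`Mmod = ⊤` at every column. [folklore] -/
theorem indNoEffect_holds : III_c_IndNoEffect (L p) :=
  ⟨fun _ _ hΦ v _ => image_Psi_of_actsBySigns p (actsBySigns_of_mem_union hΦ) v,
    fun _ Φ _ j => Set.image_univ_of_surjective (signShells.globalAut Φ j.1).surjective⟩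

/-- Rmk. 3.11.4 (i) (invisibility of the root-of-unity = (Ind2) indeterminacies) holds in the naive model. [folklore] -/
theorem invisibleRootsOfUnity_holds : III_c_InvisibleRootsOfUnity (L p) :=
  invisibleRootsOfUnity_of_indNoEffect (L p) (indNoEffect_holds p)

/-- **The whole print-sense typing `Thm311PrintSense_2` HOLDS at the model of record** (any prime `p`). [folklore] -/
theorem printSense_2_holds [Fact p.Prime] : Thm311PrintSense_2 (L p) :=
  have h := charitable_2_minus_square_holds p
  ⟨h.1, h.2.1, ⟨h.2.2.1, h.2.2.2.1, invisibleRootsOfUnity_holds p, h.2.2.2.2⟩⟩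

end model

/-! ## 2. (b) for the print-sense typing: the pinned countermodel of record -/

/-- **COUNTERMODEL (b) for `Thm311PrintSense_2`**: the typed Thm 3.11 of record, the bridge hypotheses, `|log(q)| > 0`, the three pins,
the print-sense typing AND its strong variant `III_c_IndNoEffect` hold at `(toyIndex, naiveFull 2, pinnedSetting 2, orbitRegion 2, qDatum 2)`
— with `¬ S`, `¬ Statement` and honest volumes `−|log(Θ)| = (5/2)·(−|log(q)|)`. [folklore] -/
theorem countermodel_printSense :
    ∃ (T : ThetaIndex) (F : FullSituation T) (P : Cor312.Setting F.toLatticeSituation.toSituation)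
      (ρ : (∀ v : T.V, v ∈ T.Vbad → Set (F.L.StarPacket v)) → ∀ (j : T.Label) (vQ : T.VQ), Set (F.L.Packet j vQ))
      (qK : ∀ v : T.V, v ∈ T.Vbad → Set (F.L.StarPacket v)),
      F.Statement ∧ BridgeHyps P ∧ P.AbsLogQPos ∧ PinnedRegions3 F.toLatticeSituation P ρ qK ∧
      Thm311PrintSense_2 F.toLatticeSituation ∧ III_c_IndNoEffect F.toLatticeSituation ∧
      ¬ PilotKummerIndRelated F.toLatticeSituation P ρ qK ∧ ¬ P.Statement ∧
      P.negLogTheta = (((5 : ℝ) / 2 * P.negLogQ : ℝ) : WithTop ℝ) :=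
  ⟨toyIndex, naiveFull 2, pinnedSetting 2, orbitRegion 2, qDatum 2, naiveFull_statement 2, pinnedSetting_bridgeHyps 2,
    pinnedSetting_absLogQPos 2, pinnedSetting_pinnedRegions3 2, printSense_2_holds 2, indNoEffect_holds 2,
    pinnedSetting_not_pilotKummerIndRelated 2, pinnedSetting_not_statement 2, pinnedSetting_negLogTheta_eq_mul_negLogQ 2⟩

/-- **«typed Thm 3.11 ∧ BridgeHyps ∧ |log(q)|>0 ∧ Thm311PrintSense_2 ∧ III_c_IndNoEffect ∧ PinnedRegions3 ⟹ S» is REFUTED as a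
schema.** [claim: Mochizuki2012, status: disputed] -/
@[claim "Mochizuki2012" "disputed"]
theorem not_derivation_printSense :
    ¬ ∀ (T : ThetaIndex) (F : FullSituation T) (P : Cor312.Setting F.toLatticeSituation.toSituation)
        (ρ : (∀ v : T.V, v ∈ T.Vbad → Set (F.L.StarPacket v)) → ∀ (j : T.Label) (vQ : T.VQ), Set (F.L.Packet j vQ))
        (qK : ∀ v : T.V, v ∈ T.Vbad → Set (F.L.StarPacket v)),
        F.Statement → BridgeHyps P → P.AbsLogQPos → Thm311PrintSense_2 F.toLatticeSituation →
          III_c_IndNoEffect F.toLatticeSituation → PinnedRegions3 F.toLatticeSituation P ρ qK →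
            PilotKummerIndRelated F.toLatticeSituation P ρ qK :=
  fun h => pinnedSetting_not_pilotKummerIndRelated 2 (h _ _ _ _ _ (naiveFull_statement 2) (pinnedSetting_bridgeHyps 2)
    (pinnedSetting_absLogQPos 2) (printSense_2_holds 2) (indNoEffect_holds 2) (pinnedSetting_pinnedRegions3 2))

/-- … nor does the print-sense typing give the typed inequality of Cor. 3.12 under the pins. [claim: Mochizuki2012, status: disputed] -/
@[claim "Mochizuki2012" "disputed"]
theorem not_derivation_printSense_statement :
    ¬ ∀ (T : ThetaIndex) (F : FullSituation T) (P : Cor312.Setting F.toLatticeSituation.toSituation)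
        (ρ : (∀ v : T.V, v ∈ T.Vbad → Set (F.L.StarPacket v)) → ∀ (j : T.Label) (vQ : T.VQ), Set (F.L.Packet j vQ))
        (qK : ∀ v : T.V, v ∈ T.Vbad → Set (F.L.StarPacket v)),
        F.Statement → BridgeHyps P → P.AbsLogQPos → Thm311PrintSense_2 F.toLatticeSituation →
          III_c_IndNoEffect F.toLatticeSituation → PinnedRegions3 F.toLatticeSituation P ρ qK → P.Statement :=
  fun h => pinnedSetting_not_statement 2 (h _ _ _ _ _ (naiveFull_statement 2) (pinnedSetting_bridgeHyps 2)
    (pinnedSetting_absLogQPos 2) (printSense_2_holds 2) (indNoEffect_holds 2) (pinnedSetting_pinnedRegions3 2))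

/-! ## 3. INDEPENDENCE: the print-sense typing also sits on a pinned model where `S` holds -/

section independence
variable (p : ℕ) [hp : Fact p.Prime]

/-- At the identified-copies setting `idSetting` (q-regions := `B_{j²}`, q-datum := `Ψ`) the print-sense typing, its strong variant,
the three pins, the bridge hypotheses and `|log(q)| > 0` hold — together with `S` and the inequality. [folklore] -/
theorem printSense_with_S :
    Thm311PrintSense_2 (L p) ∧ III_c_IndNoEffect (L p) ∧ PinnedRegions3 (L p) (idSetting p) (orbitRegion p) (thetaDatum p) ∧
      BridgeHyps (idSetting p) ∧ (idSetting p).AbsLogQPos ∧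
      PilotKummerIndRelated (L p) (idSetting p) (orbitRegion p) (thetaDatum p) ∧ (idSetting p).Statement :=
  have h := charitable_2_nonvacuous p
  ⟨printSense_2_holds p, indNoEffect_holds p, h.2.2.1, h.2.2.2.1, h.2.2.2.2.1, h.2.2.2.2.2.1, h.2.2.2.2.2.2⟩

end independence

/-- **`S` is INDEPENDENT of «typed Thm 3.11 ∧ Thm311PrintSense_2 ∧ III_c_IndNoEffect ∧ three pins ∧ BridgeHyps ∧ |log(q)|>0»**: one
pinned model of all of it with `¬ S` (and `¬ Statement`), another with `S` (and `Statement`). [claim: Mochizuki2012, status: disputed] -/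
@[claim "Mochizuki2012" "disputed"]
theorem printSense_independent_of_S :
    (∃ (T : ThetaIndex) (F : FullSituation T) (P : Cor312.Setting F.toLatticeSituation.toSituation)
      (ρ : (∀ v : T.V, v ∈ T.Vbad → Set (F.L.StarPacket v)) → ∀ (j : T.Label) (vQ : T.VQ), Set (F.L.Packet j vQ))
      (qK : ∀ v : T.V, v ∈ T.Vbad → Set (F.L.StarPacket v)),
      F.Statement ∧ BridgeHyps P ∧ P.AbsLogQPos ∧ PinnedRegions3 F.toLatticeSituation P ρ qK ∧
      Thm311PrintSense_2 F.toLatticeSituation ∧ III_c_IndNoEffect F.toLatticeSituation ∧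
      ¬ PilotKummerIndRelated F.toLatticeSituation P ρ qK ∧ ¬ P.Statement) ∧
    (∃ (T : ThetaIndex) (F : FullSituation T) (P : Cor312.Setting F.toLatticeSituation.toSituation)
      (ρ : (∀ v : T.V, v ∈ T.Vbad → Set (F.L.StarPacket v)) → ∀ (j : T.Label) (vQ : T.VQ), Set (F.L.Packet j vQ))
      (qK : ∀ v : T.V, v ∈ T.Vbad → Set (F.L.StarPacket v)),
      F.Statement ∧ BridgeHyps P ∧ P.AbsLogQPos ∧ PinnedRegions3 F.toLatticeSituation P ρ qK ∧
      Thm311PrintSense_2 F.toLatticeSituation ∧ III_c_IndNoEffect F.toLatticeSituation ∧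
      PilotKummerIndRelated F.toLatticeSituation P ρ qK ∧ P.Statement) :=
  ⟨⟨toyIndex, naiveFull 2, pinnedSetting 2, orbitRegion 2, qDatum 2, naiveFull_statement 2, pinnedSetting_bridgeHyps 2,
      pinnedSetting_absLogQPos 2, pinnedSetting_pinnedRegions3 2, printSense_2_holds 2, indNoEffect_holds 2,
      pinnedSetting_not_pilotKummerIndRelated 2, pinnedSetting_not_statement 2⟩,
    ⟨toyIndex, naiveFull 2, idSetting 2, orbitRegion 2, thetaDatum 2, naiveFull_statement 2, (printSense_with_S 2).2.2.2.1,
      (printSense_with_S 2).2.2.2.2.1, (printSense_with_S 2).2.2.1, printSense_2_holds 2, indNoEffect_holds 2,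
      (printSense_with_S 2).2.2.2.2.2.1, (printSense_with_S 2).2.2.2.2.2.2⟩⟩

end Summit.ABC.IUTFork.Charitable.D2

end
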